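import Literature.MathematicalPhysics.QuantumFieldTheory.Balaban1983to89.B8Prop5ContractionKLevelPer
import Literature.MathematicalPhysics.QuantumFieldTheory.Balaban1983to89.B8Prop5ContractionKLevelSrc

/-!
# `Balaban1983to89.B8Prop5ContractionKLevelSrcPer` — [Balaban1985RegularSpaces] Prop. 5 (pp. 92–94) AT THEOREM 8's SOURCED GAUGE CONDITION (1.146) p. 101:
# the fixed point of (1.100) for the SOURCED nonlinearity `Ψ_f` (`W ↦ W − f`) at `k` levels, RUN ON THE `P`-PERIODIC CONFIGURATIONS (§3 p. 98) — the
# periodic × sourced merge of t2s-1's `B8Prop5ContractionKLevelPer` and dag-n05-d's `B8Prop5ContractionKLevelSrc`; root engine of instance (ii) of the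
# interface request B8-P5-NESTED-SERVER (both halves)

statement-level skeleton of published theorems with citation tags; proofs where landed; nothing here is a claim about the Yang–Mills mass gap

T. Bałaban, *Spaces of regular gauge field configurations on a lattice and gauge fixing conditions*, Commun. Math. Phys. **99** (1985) 75–102
`[Balaban1985RegularSpaces]` ("B8"; journal page = PDF page + 74): (1.95)–(1.99) pp. 92–93, (1.100)–(1.103) p. 93, (1.106), (1.107)–(1.108) p. 94, Thm 8 (1.146)
p. 101 («only some constants change»), p. 77 («Ω_j ⊂ T_η»), §3 p. 98.  STATUS: published, refereed.

CITATION HEADER (lean-in-tree rule).  Cell `lit-balaban`, seat `lit-balaban-p21` (gen 39), sub-row «G-B8-T2S» (R3 `stmt-QuantumFields-19200`, `--supports`, helper).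
Interface request B8-P5-NESTED-SERVER (pub-ymgap dag-n05-c g17, 2026-08-28), instance (ii) «Theorem 8's source, `LanF a U₀ f m W ↔ IsLandau146W …`»: the
nested periodic servers of T5's Prop-5 sockets at the sourced gauge condition need the Prop-5 engine stack in the PERIODIC × SOURCED edition; the tree holds the
periodic edition (t2s-1, RULING #4 of «G-B8-T2S») and the sourced edition (dag-n05-d) separately.  THIS FILE is the root of the merged stack.

WHAT IS PROVED (theorems only, no `def`; every proof is the Per file's with `PsiP5 ↦ PsiP5src`, `W ↦ W − f`, the windows read at `mE + m_f∕2` — token for token).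
§1 `psiP5src_bd2_at`, `psiP5src_sub_bd2_at` — `B8Prop5ContractionKLevelSrc.psiP5src_bd2 ∕ psiP5src_sub_bd2` ((1.98)R + (1.99) with `|W − f|₍₋₂₎ ≤ mWc + m_f`,
   (1.106) — the source cancels in `W_s − W_t`) with the sizes∕moduli of `gpar`, `Eterm` read AT THE ONE (resp. TWO) configuration(s) instead of on the ball
   (the `_at` pattern of `B8Prop5ContractionKLevelPer`).
§1 ★ `propFive_fixedPoint_kLevel_src_per` — `B8Prop5ContractionKLevelPer.propFive_fixedPoint_kLevel_per` for `Ψ_f`: `hg0 hg1 hgL hE0 hEL` at PERIODIC `λ_s, λ_t`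
   only, `G′` periodic-valued, the source `f` with `|f|₍₋₂₎ ≤ m_f`, smallness at `Mc ∕ Kc` read at `mE + m_f∕2`; conclusion: EXACTLY ONE `P`-periodic `s` in the
   ¼α₄-ball with `λ_s = G′(Ψ_f λ_s)` (`B8LambdaSpaceKLevelOn.fixedPoint_kLevel_per`).
§1 `propFive_fixedPoint_kLevel_src_spec_per` — what the periodic sourced fixed point carries: the Neumann identity WITH SOURCE `Z′ + V_{λ′}(RZ′) = W − f`,
   `|Z′|₍₋₂₎ ≤ 2·mWc(mE + m_f∕2)`, `‖s‖ ≤ B_G·M`, `λ_s = 0` off `Ω₀`.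
§2 `psiP5src_real_at`, ★ `propFive_fixedPoint_kLevel_src_selfAdjoint_per` — reality: `G′(Ψ_f λ)` Hermitian for Hermitian data and HERMITIAN SOURCE, at one
   `λ`; the periodic sourced fixed point is Hermitian (`B8LambdaSpaceKLevelOn.fixedPoint_kLevel_per_selfAdjoint`).

HONEST SCOPE.  Verbatim re-threads (merge by pattern of two landed editions); [4], (1.99), Sect. E NOT proved (displayed hypotheses); count-neutral; N05 ∕
`stub_PV3A` NOT discharged; nothing continuum ∕ ℝ⁴ ∕ OS ∕ mass-gap ∕ Clay — the Yang–Mills mass gap is NOT proved.  No `sorry`, no `def`, no `… : Prop` fact,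
no `instance`, no `notation`.

RELATED IN THE TREE, NOT DUPLICATED: `B8Prop5ContractionKLevelPer` (t2s-1; periodic, zero source), `B8Prop5ContractionKLevelSrc` (dag-n05-d; sourced, all of `ℤᵈ`),
`B8Prop5ContractionKLevel` (n04-b; the engine), `B8LambdaSpaceKLevelOn` (t2s-1; the contraction on a closed subset, USED).
-/

noncomputable section

open NormedSpace Metric Set Filter Topology
open Complex (I)

namespace Literature.MathematicalPhysics.QuantumFieldTheory.Balaban1983to89.B8Prop5ContractionKLevelSrcPer

open B7Prop1Explicit (e expUnit)
open B7Prop2Explicit (unitaryUnits)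
open B7Eq78Linearization (conjR conjR_apply conjR_add conjR_sub conjR_smul)
open B8Ineq132 (covDerivFwd covDeriv)
open B8LambdaSpaceKLevel (wt lamSubK lamOf norm_le_iff)
open B8LambdaSpaceKLevelOn (fixedPoint_kLevel_per fixedPoint_kLevel_per_selfAdjoint)
open B8Prop5ContractionKLevel (Bd2 Zsol Vop Wsrc PsiP5 Mc Kc mWc KWc mWc_nonneg KWc_nonneg Vop_sub norm_Vop_le norm_Vop_sub_Vop_le bd2_zsol
  bd2_zsol_sub_zsol zsol_eq wt_sq_norm_Wsrc_le wt_sq_norm_Wsrc_sub_le Bd2.neg Bd2.mono)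
open B8Prop5ContractionKLevelSrc (PsiP5src mWc_add_half KWc_le_add_half)
open B8Prop5Reality (isSelfAdjoint_Wsrc isSelfAdjoint_Vop isSelfAdjoint_zsol)

-- `Site` alone could resolve to the torus sites of `Setup.lean`; re-export the `ℤ^d` sites of `B7Prop1Explicit`.
export B7Prop1Explicit (Site)

variable {d : ℕ}

/-! ## §1 The sourced contraction on the periodic configurations -/

section General

variable {𝔸 : Type*} [NormedRing 𝔸] [NormOneClass 𝔸] [NormedAlgebra ℂ 𝔸] [CompleteSpace 𝔸]
variable {L k : ℕ} {η : ℝ} {Ω : ℕ → Set (Site d)} {Eb : ℕ → Set (Site d × Fin d)} {U₀ : Site d → Fin d → 𝔸ˣ}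
  {A : Site d → Fin d → 𝔸} {DA f : Site d → 𝔸}

/-- **(1.98)R + (1.99) for `Ψ_f = R(−Z′_λ)` AT ONE `λ`**: `|Ψ_f(λ)|₍₋₂₎ ≤ Mc … (mE + m_f∕2) …` from the sizes of `λ′ = gpar λ`, `Eterm λ`, `A`, `D*A` at that
`λ` and `|f|₍₋₂₎ ≤ m_f` (`psiP5src_bd2` read at `λ`; `|W − f|₍₋₂₎ ≤ mWc + m_f = mWc(mE + m_f∕2)`). [cite: Balaban1985RegularSpaces, (1.98)–(1.99) pp.92–93, Thm 8 (1.146) p.101] -/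
theorem psiP5src_bd2_at (hL : 1 ≤ L) (hη : 0 < η) (R gpar Eterm : (Site d → 𝔸) → (Site d → 𝔸))
    {BR a₁ b₁ cA cDA mE mf : ℝ}
    (hBR : 0 ≤ BR) (ha₁ : 0 ≤ a₁) (ha₁' : a₁ ≤ 1 / 24) (hb₁ : 0 < b₁) (hb₁' : b₁ ≤ 1 / 140)
    (hcA : 0 ≤ cA) (hcA' : cA ≤ 1 / 13) (hcDA : 0 ≤ cDA) (hmE : 0 ≤ mE) (hmf : 0 ≤ mf) (hθ : 10 * a₁ * BR ≤ 1 / 2)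
    (hRsub : ∀ f g : Site d → 𝔸, R (f - g) = R f - R g)
    (hRbd : ∀ (f : Site d → 𝔸) (m : ℝ), 0 ≤ m → Bd2 L η k Ω f m → Bd2 L η k Ω (R f) (BR * m))
    {lam : Site d → 𝔸} (hg0 : ∀ j, j ≤ k → ∀ x ∈ Ω j, ‖gpar lam x‖ ≤ a₁)
    (hg1 : ∀ j, j ≤ k → ∀ x ∈ Ω j, ∀ μ : Fin d,
      wt L η j * ‖covDerivFwd η U₀ μ (gpar lam) x‖ ≤ b₁ ∧ wt L η j * ‖covDeriv η U₀ μ (gpar lam) x‖ ≤ b₁)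
    (hE0 : Bd2 L η k Ω (Eterm lam) mE)
    (hDA : Bd2 L η k Ω DA cDA) (hf : Bd2 L η k Ω f mf)
    (hA : ∀ j, j ≤ k → ∀ x ∈ Ω j, ∀ μ : Fin d,
      wt L η j * ‖A x μ‖ ≤ cA ∧ wt L η j * ‖conjR (U₀ (x - e μ) μ)⁻¹ (A (x - e μ) μ)‖ ≤ cA) :
    Bd2 L η k Ω (PsiP5src η U₀ A DA f R gpar Eterm lam) (Mc d BR b₁ cA (mE + mf / 2) cDA) := by
  have hmW : 0 ≤ mWc d b₁ cA mE cDA := mWc_nonneg hb₁.le hcA hmE hcDA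
  have hmW' : 0 ≤ mWc d b₁ cA (mE + mf / 2) cDA := mWc_nonneg hb₁.le hcA (by positivity) hcDA
  have hcV : 0 ≤ 10 * a₁ := by positivity
  have ha12 : a₁ ≤ 1 / 12 := by linarith
  have hb70 : b₁ ≤ 1 / 70 := by linarith
  have hcA12 : cA ≤ 1 / 12 := by linarith
  have hVsub : ∀ f g : Site d → 𝔸, ∀ j, j ≤ k → ∀ x ∈ Ω j,
      Vop (gpar lam) f x - Vop (gpar lam) g x = Vop (gpar lam) (f - g) x :=
    fun f g j hj x hx => Vop_sub f g ((hg0 j hj x hx).trans ha12)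
  have hVbd : ∀ f : Site d → 𝔸, ∀ j, j ≤ k → ∀ x ∈ Ω j, ‖Vop (gpar lam) f x‖ ≤ 10 * a₁ * ‖f x‖ :=
    fun f j hj x hx => norm_Vop_le f (hg0 j hj x hx) ha12
  have hW0 : Bd2 L η k Ω (Wsrc η U₀ A DA (gpar lam) (Eterm lam)) (mWc d b₁ cA mE cDA) :=
    fun j hj x hx => wt_sq_norm_Wsrc_le hL hη hb70 hcA hcA12 ((hg0 j hj x hx).trans ha12) (hg1 j hj x hx) (hA j hj x hx)
      (hE0 j hj x hx) (hDA j hj x hx)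
  have hW : Bd2 L η k Ω (Wsrc η U₀ A DA (gpar lam) (Eterm lam) - f) (mWc d b₁ cA (mE + mf / 2) cDA) := by
    rw [← mWc_add_half]; exact hW0.sub hf
  have hZ := bd2_zsol hL hη hVsub hVbd hRsub hRbd hW hcV hBR hmW' hθ
  exact hRbd _ _ (by positivity) hZ.neg

/-- **(1.106) for `Ψ_f = R(−Z′)` AT TWO CONFIGURATIONS `λ, λ′`**: `|Ψ_f(λ) − Ψ_f(λ′)|₍₋₂₎ ≤ Kc … (mE + m_f∕2) … ·δ` from the sizes at `λ`, `λ′`, the moduli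
`ℓ₀δ`, `ℓ₁δ`, `K_Eδ` of `gpar`, `Eterm` between them and `|f|₍₋₂₎ ≤ m_f` (`psiP5src_sub_bd2` read at the pair; the source cancels in `W_λ − W_λ′`,
`KWc(mE) ≤ KWc(mE + m_f∕2)`). [cite: Balaban1985RegularSpaces, (1.104)–(1.106) p.94, Thm 8 (1.146) p.101] -/
theorem psiP5src_sub_bd2_at (hL : 1 ≤ L) (hη : 0 < η) (R gpar Eterm : (Site d → 𝔸) → (Site d → 𝔸))
    {BR a₁ b₁ cA cDA mE KE ℓ₀ ℓ₁ mf δ : ℝ} (hδ : 0 ≤ δ)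
    (hBR : 0 ≤ BR) (ha₁ : 0 ≤ a₁) (ha₁' : a₁ ≤ 1 / 24) (hb₁ : 0 < b₁) (hb₁' : b₁ ≤ 1 / 140)
    (hcA : 0 ≤ cA) (hcA' : cA ≤ 1 / 13) (hcDA : 0 ≤ cDA) (hmE : 0 ≤ mE) (hKE : 0 ≤ KE) (hℓ₀ : 0 ≤ ℓ₀) (hℓ₁ : 0 ≤ ℓ₁) (hmf : 0 ≤ mf)
    (hθ : 10 * a₁ * BR ≤ 1 / 2)
    (hRsub : ∀ f g : Site d → 𝔸, R (f - g) = R f - R g)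
    (hRbd : ∀ (f : Site d → 𝔸) (m : ℝ), 0 ≤ m → Bd2 L η k Ω f m → Bd2 L η k Ω (R f) (BR * m))
    {lam lam' : Site d → 𝔸} (hg0 : ∀ j, j ≤ k → ∀ x ∈ Ω j, ‖gpar lam x‖ ≤ a₁) (hg0' : ∀ j, j ≤ k → ∀ x ∈ Ω j, ‖gpar lam' x‖ ≤ a₁)
    (hg1 : ∀ j, j ≤ k → ∀ x ∈ Ω j, ∀ μ : Fin d,
      wt L η j * ‖covDerivFwd η U₀ μ (gpar lam) x‖ ≤ b₁ ∧ wt L η j * ‖covDeriv η U₀ μ (gpar lam) x‖ ≤ b₁)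
    (hg1' : ∀ j, j ≤ k → ∀ x ∈ Ω j, ∀ μ : Fin d,
      wt L η j * ‖covDerivFwd η U₀ μ (gpar lam') x‖ ≤ b₁ ∧ wt L η j * ‖covDeriv η U₀ μ (gpar lam') x‖ ≤ b₁)
    (hgL : ∀ j, j ≤ k → ∀ x ∈ Ω j,
      ‖gpar lam x - gpar lam' x‖ ≤ ℓ₀ * δ ∧ ∀ μ : Fin d,
        wt L η j * ‖covDerivFwd η U₀ μ (gpar lam - gpar lam') x‖ ≤ ℓ₁ * δ ∧
        wt L η j * ‖covDeriv η U₀ μ (gpar lam - gpar lam') x‖ ≤ ℓ₁ * δ)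
    (hE0 : Bd2 L η k Ω (Eterm lam) mE) (hE0' : Bd2 L η k Ω (Eterm lam') mE)
    (hEL : Bd2 L η k Ω (Eterm lam - Eterm lam') (KE * δ))
    (hDA : Bd2 L η k Ω DA cDA) (hf : Bd2 L η k Ω f mf)
    (hA : ∀ j, j ≤ k → ∀ x ∈ Ω j, ∀ μ : Fin d,
      wt L η j * ‖A x μ‖ ≤ cA ∧ wt L η j * ‖conjR (U₀ (x - e μ) μ)⁻¹ (A (x - e μ) μ)‖ ≤ cA) :
    Bd2 L η k Ω (PsiP5src η U₀ A DA f R gpar Eterm lam - PsiP5src η U₀ A DA f R gpar Eterm lam')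
      (Kc d BR b₁ cA (mE + mf / 2) cDA KE ℓ₀ ℓ₁ * δ) := by
  set mW := mWc d b₁ cA (mE + mf / 2) cDA with hmWdef
  have hmE' : 0 ≤ mE + mf / 2 := by positivity
  have hmW : 0 ≤ mW := mWc_nonneg hb₁.le hcA hmE' hcDA
  have hcV : 0 ≤ 10 * a₁ := by positivity
  have ha12 : a₁ ≤ 1 / 12 := by linarith
  have hb70 : b₁ ≤ 1 / 70 := by linarith
  have hcA12 : cA ≤ 1 / 12 := by linarith
  have hVsub : ∀ f g : Site d → 𝔸, ∀ j, j ≤ k → ∀ x ∈ Ω j, Vop (gpar lam) f x - Vop (gpar lam) g x = Vop (gpar lam) (f - g) x :=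
    fun f g j hj x hx => Vop_sub f g ((hg0 j hj x hx).trans ha12)
  have hVsub' : ∀ f g : Site d → 𝔸, ∀ j, j ≤ k → ∀ x ∈ Ω j, Vop (gpar lam') f x - Vop (gpar lam') g x = Vop (gpar lam') (f - g) x :=
    fun f g j hj x hx => Vop_sub f g ((hg0' j hj x hx).trans ha12)
  have hVbd : ∀ f : Site d → 𝔸, ∀ j, j ≤ k → ∀ x ∈ Ω j, ‖Vop (gpar lam) f x‖ ≤ 10 * a₁ * ‖f x‖ :=
    fun f j hj x hx => norm_Vop_le f (hg0 j hj x hx) ha12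
  have hVbd' : ∀ f : Site d → 𝔸, ∀ j, j ≤ k → ∀ x ∈ Ω j, ‖Vop (gpar lam') f x‖ ≤ 10 * a₁ * ‖f x‖ :=
    fun f j hj x hx => norm_Vop_le f (hg0' j hj x hx) ha12
  have hW : Bd2 L η k Ω (Wsrc η U₀ A DA (gpar lam) (Eterm lam) - f) mW := by
    have h : Bd2 L η k Ω (Wsrc η U₀ A DA (gpar lam) (Eterm lam)) (mWc d b₁ cA mE cDA) :=
      fun j hj x hx => wt_sq_norm_Wsrc_le hL hη hb70 hcA hcA12 ((hg0 j hj x hx).trans ha12) (hg1 j hj x hx) (hA j hj x hx)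
        (hE0 j hj x hx) (hDA j hj x hx)
    rw [hmWdef, ← mWc_add_half]; exact h.sub hf
  have hW' : Bd2 L η k Ω (Wsrc η U₀ A DA (gpar lam') (Eterm lam') - f) mW := by
    have h : Bd2 L η k Ω (Wsrc η U₀ A DA (gpar lam') (Eterm lam')) (mWc d b₁ cA mE cDA) :=
      fun j hj x hx => wt_sq_norm_Wsrc_le hL hη hb70 hcA hcA12 ((hg0' j hj x hx).trans ha12) (hg1' j hj x hx) (hA j hj x hx)
        (hE0' j hj x hx) (hDA j hj x hx)
    rw [hmWdef, ← mWc_add_half]; exact h.sub hf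
  have hKW : 0 ≤ KWc d b₁ cA mE cDA KE ℓ₀ ℓ₁ := KWc_nonneg hb₁.le hcA hmE hcDA hKE hℓ₀ hℓ₁
  have hKW' : 0 ≤ KWc d b₁ cA (mE + mf / 2) cDA KE ℓ₀ ℓ₁ := KWc_nonneg hb₁.le hcA hmE' hcDA hKE hℓ₀ hℓ₁
  -- the source cancels in `W_λ − W_λ′`: the engine's modulus, then monotonicity in `mE`
  have hdW : Bd2 L η k Ω ((Wsrc η U₀ A DA (gpar lam) (Eterm lam) - f) - (Wsrc η U₀ A DA (gpar lam') (Eterm lam') - f))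
      (KWc d b₁ cA (mE + mf / 2) cDA KE ℓ₀ ℓ₁ * δ) := by
    intro j hj x hx
    have h := wt_sq_norm_Wsrc_sub_le (U₀ := U₀) (A := A) (DA := DA) hL hη hb₁ hb₁' hcA hcA' (by positivity : 0 ≤ ℓ₀ * δ)
      ((hg0 j hj x hx).trans ha₁') ((hg0' j hj x hx).trans ha₁') (hg1 j hj x hx) (hg1' j hj x hx) (hA j hj x hx)
      (hE0' j hj x hx) (hDA j hj x hx) (hgL j hj x hx).1 (fun μ => (hgL j hj x hx).2 μ)
      (by simpa only [Pi.sub_apply] using hEL j hj x hx)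
    have hcancel : ((Wsrc η U₀ A DA (gpar lam) (Eterm lam) - f) - (Wsrc η U₀ A DA (gpar lam') (Eterm lam') - f)) x =
        Wsrc η U₀ A DA (gpar lam) (Eterm lam) x - Wsrc η U₀ A DA (gpar lam') (Eterm lam') x := by
      simp only [Pi.sub_apply]; abel
    rw [hcancel]
    refine h.trans ?_
    have heq : 18 * cDA * (ℓ₀ * δ) + 2 * (KE * δ) + 10 * mE * (ℓ₀ * δ) +
        d * (438 * b₁ * (ℓ₁ * δ) + 1968 * b₁ ^ 2 * (ℓ₀ * δ) + 68 * cA * (ℓ₁ * δ) + 808 * cA * b₁ * (ℓ₀ * δ)) =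
        KWc d b₁ cA mE cDA KE ℓ₀ ℓ₁ * δ := by unfold KWc; ring
    rw [heq]
    exact mul_le_mul_of_nonneg_right (KWc_le_add_half d hmf hℓ₀) hδ
  have hdV : ∀ g : Site d → 𝔸, ∀ j, j ≤ k → ∀ x ∈ Ω j,
      ‖Vop (gpar lam) g x - Vop (gpar lam') g x‖ ≤ 10 * ℓ₀ * δ * ‖g x‖ := by
    intro g j hj x hx
    have h := norm_Vop_sub_Vop_le g ((hg0 j hj x hx).trans ha12) ((hg0' j hj x hx).trans ha12)
    calc ‖Vop (gpar lam) g x - Vop (gpar lam') g x‖ ≤ 10 * ‖g x‖ * ‖gpar lam x - gpar lam' x‖ := h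
      _ ≤ 10 * ‖g x‖ * (ℓ₀ * δ) := by gcongr; exact (hgL j hj x hx).1
      _ = 10 * ℓ₀ * δ * ‖g x‖ := by ring
  have hZZ := bd2_zsol_sub_zsol hL hη hVsub hVbd hVsub' hVbd' hRsub hRbd hW hW' hcV hBR hmW hθ
    (mul_nonneg hKW' hδ) (by positivity : 0 ≤ 10 * ℓ₀ * δ) hdW hdV
  have h2c : 0 ≤ 2 * (KWc d b₁ cA (mE + mf / 2) cDA KE ℓ₀ ℓ₁ * δ + 10 * ℓ₀ * δ * (BR * (2 * mW))) := by positivity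
  have hneg := hRbd _ _ h2c hZZ.neg
  intro j hj x hx
  have h := hneg j hj x hx
  have heq : (PsiP5src η U₀ A DA f R gpar Eterm lam - PsiP5src η U₀ A DA f R gpar Eterm lam') x =
      R (-(Zsol (Wsrc η U₀ A DA (gpar lam) (Eterm lam) - f) (Vop (gpar lam)) R -
        Zsol (Wsrc η U₀ A DA (gpar lam') (Eterm lam') - f) (Vop (gpar lam')) R)) x := by
    simp only [PsiP5src, Pi.sub_apply]
    rw [← Pi.sub_apply (R _) (R _), ← hRsub]
    congr 1
    funext y; simp only [Pi.sub_apply, Pi.neg_apply]; abel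
  rw [heq]
  refine h.trans (le_of_eq ?_)
  unfold Kc; ring

/-- ★ **PROPOSITION 5's FIXED POINT OF (1.100) WITH A SOURCE, AT `k` LEVELS, ON THE `P`-PERIODIC CONFIGURATIONS** —
`B8Prop5ContractionKLevelPer.propFive_fixedPoint_kLevel_per` for the sourced nonlinearity `Ψ_f` (Theorem 8's (1.146); `B8Prop5ContractionKLevelSrc.PsiP5src`):
`hg0`, `hg1`, `hgL`, `hE0`, `hEL` at PERIODIC `λ_s`, `λ_t` only, `G′` periodic-valued (`hGper`), a source `f` with `|f|₍₋₂₎ ≤ m_f` on the `Ω_j`, the two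
smallness conditions (1.103)∕(1.106) read at `mE + m_f∕2`: exactly one `P`-periodic `s` in the ¼α₄-ball with `λ_s = G′(Ψ_f λ_s)`.
[cite: Balaban1985RegularSpaces, p.94 (after (1.106)), (1.100)–(1.103) p.93, (1.96)–(1.99) pp.92–93, Thm 8 (1.146) p.101, p.77 («Ω_j = T_η»), §3 p.98] -/
theorem propFive_fixedPoint_kLevel_src_per (hL : 1 ≤ L) (hη : 0 < η) (P : ℤ)
    (Gp R gpar Eterm : (Site d → 𝔸) → (Site d → 𝔸))
    {α₄ BG BR a₁ b₁ cA cDA mE KE ℓ₀ ℓ₁ mf : ℝ}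
    (hα₄ : 0 ≤ α₄) (hBG : 0 ≤ BG) (hBR : 0 ≤ BR) (ha₁ : 0 ≤ a₁) (ha₁' : a₁ ≤ 1 / 24) (hb₁ : 0 < b₁) (hb₁' : b₁ ≤ 1 / 140)
    (hcA : 0 ≤ cA) (hcA' : cA ≤ 1 / 13) (hcDA : 0 ≤ cDA) (hmE : 0 ≤ mE) (hKE : 0 ≤ KE) (hℓ₀ : 0 ≤ ℓ₀) (hℓ₁ : 0 ≤ ℓ₁) (hmf : 0 ≤ mf)
    (hθ : 10 * a₁ * BR ≤ 1 / 2)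
    (hG : ∀ (f : Site d → 𝔸) (m : ℝ), 0 ≤ m → Bd2 L η k Ω f m →
      (∀ x, ‖Gp f x‖ ≤ BG * m) ∧ ∀ j, j ≤ k → ∀ p ∈ Eb j, wt L η j * ‖covDerivFwd η U₀ p.2 (Gp f) p.1‖ ≤ BG * m)
    (hGsub : ∀ f g : Site d → 𝔸, Gp (f - g) = Gp f - Gp g)
    (hGper : ∀ (f : Site d → 𝔸) (z : Site d) (i : Fin d), Gp f (z + P • e i) = Gp f z)
    (hRsub : ∀ f g : Site d → 𝔸, R (f - g) = R f - R g)
    (hRbd : ∀ (f : Site d → 𝔸) (m : ℝ), 0 ≤ m → Bd2 L η k Ω f m → Bd2 L η k Ω (R f) (BR * m))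
    (hg0 : ∀ s : lamSubK η U₀ L k Eb, (∀ (z : Site d) (i : Fin d), lamOf s (z + P • e i) = lamOf s z) → ‖s‖ ≤ α₄ / 4 →
      ∀ j, j ≤ k → ∀ x ∈ Ω j, ‖gpar (lamOf s) x‖ ≤ a₁)
    (hg1 : ∀ s : lamSubK η U₀ L k Eb, (∀ (z : Site d) (i : Fin d), lamOf s (z + P • e i) = lamOf s z) → ‖s‖ ≤ α₄ / 4 →
      ∀ j, j ≤ k → ∀ x ∈ Ω j, ∀ μ : Fin d,
      wt L η j * ‖covDerivFwd η U₀ μ (gpar (lamOf s)) x‖ ≤ b₁ ∧ wt L η j * ‖covDeriv η U₀ μ (gpar (lamOf s)) x‖ ≤ b₁)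
    (hgL : ∀ s t : lamSubK η U₀ L k Eb, (∀ (z : Site d) (i : Fin d), lamOf s (z + P • e i) = lamOf s z) → (∀ (z : Site d) (i : Fin d), lamOf t (z + P • e i) = lamOf t z) →
      ‖s‖ ≤ α₄ / 4 → ‖t‖ ≤ α₄ / 4 → ∀ j, j ≤ k → ∀ x ∈ Ω j,
      ‖gpar (lamOf s) x - gpar (lamOf t) x‖ ≤ ℓ₀ * ‖s - t‖ ∧ ∀ μ : Fin d,
        wt L η j * ‖covDerivFwd η U₀ μ (gpar (lamOf s) - gpar (lamOf t)) x‖ ≤ ℓ₁ * ‖s - t‖ ∧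
        wt L η j * ‖covDeriv η U₀ μ (gpar (lamOf s) - gpar (lamOf t)) x‖ ≤ ℓ₁ * ‖s - t‖)
    (hE0 : ∀ s : lamSubK η U₀ L k Eb, (∀ (z : Site d) (i : Fin d), lamOf s (z + P • e i) = lamOf s z) → ‖s‖ ≤ α₄ / 4 →
      Bd2 L η k Ω (Eterm (lamOf s)) mE)
    (hEL : ∀ s t : lamSubK η U₀ L k Eb, (∀ (z : Site d) (i : Fin d), lamOf s (z + P • e i) = lamOf s z) → (∀ (z : Site d) (i : Fin d), lamOf t (z + P • e i) = lamOf t z) →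
      ‖s‖ ≤ α₄ / 4 → ‖t‖ ≤ α₄ / 4 → Bd2 L η k Ω (Eterm (lamOf s) - Eterm (lamOf t)) (KE * ‖s - t‖))
    (hDA : Bd2 L η k Ω DA cDA) (hf : Bd2 L η k Ω f mf)
    (hA : ∀ j, j ≤ k → ∀ x ∈ Ω j, ∀ μ : Fin d,
      wt L η j * ‖A x μ‖ ≤ cA ∧ wt L η j * ‖conjR (U₀ (x - e μ) μ)⁻¹ (A (x - e μ) μ)‖ ≤ cA)
    (h103 : BG * Mc d BR b₁ cA (mE + mf / 2) cDA ≤ α₄ / 4) (h106 : BG * Kc d BR b₁ cA (mE + mf / 2) cDA KE ℓ₀ ℓ₁ ≤ 1 / 2) :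
    ∃ s : lamSubK η U₀ L k Eb, (∀ (z : Site d) (i : Fin d), lamOf s (z + P • e i) = lamOf s z) ∧ ‖s‖ ≤ α₄ / 4 ∧
      lamOf s = Gp (PsiP5src η U₀ A DA f R gpar Eterm (lamOf s)) ∧
      ∀ t : lamSubK η U₀ L k Eb, (∀ (z : Site d) (i : Fin d), lamOf t (z + P • e i) = lamOf t z) → ‖t‖ ≤ α₄ / 4 →
        lamOf t = Gp (PsiP5src η U₀ A DA f R gpar Eterm (lamOf t)) → t = s := by
  have hmE' : 0 ≤ mE + mf / 2 := by positivity
  have hmW : 0 ≤ mWc d b₁ cA (mE + mf / 2) cDA := mWc_nonneg hb₁.le hcA hmE' hcDA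
  have hKW : 0 ≤ KWc d b₁ cA (mE + mf / 2) cDA KE ℓ₀ ℓ₁ := KWc_nonneg hb₁.le hcA hmE' hcDA hKE hℓ₀ hℓ₁
  have hM0 : 0 ≤ Mc d BR b₁ cA (mE + mf / 2) cDA := by unfold Mc; positivity
  have hK0 : 0 ≤ Kc d BR b₁ cA (mE + mf / 2) cDA KE ℓ₀ ℓ₁ := by unfold Kc; positivity
  have hΨ0 : ∀ s : lamSubK η U₀ L k Eb, (∀ (z : Site d) (i : Fin d), lamOf s (z + P • e i) = lamOf s z) → ‖s‖ ≤ α₄ / 4 →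
      ∀ j, j ≤ k → ∀ x ∈ Ω j, wt L η j ^ 2 * ‖PsiP5src η U₀ A DA f R gpar Eterm (lamOf s) x‖ ≤ Mc d BR b₁ cA (mE + mf / 2) cDA :=
    fun s hp hs => psiP5src_bd2_at (Ω := Ω) hL hη R gpar Eterm hBR ha₁ ha₁' hb₁ hb₁' hcA hcA' hcDA hmE hmf hθ hRsub hRbd (hg0 s hp hs)
      (hg1 s hp hs) (hE0 s hp hs) hDA hf hA
  have hΨ1 : ∀ s t : lamSubK η U₀ L k Eb, (∀ (z : Site d) (i : Fin d), lamOf s (z + P • e i) = lamOf s z) →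
      (∀ (z : Site d) (i : Fin d), lamOf t (z + P • e i) = lamOf t z) → ‖s‖ ≤ α₄ / 4 → ‖t‖ ≤ α₄ / 4 → ∀ j, j ≤ k → ∀ x ∈ Ω j,
      wt L η j ^ 2 * ‖PsiP5src η U₀ A DA f R gpar Eterm (lamOf s) x - PsiP5src η U₀ A DA f R gpar Eterm (lamOf t) x‖ ≤
        Kc d BR b₁ cA (mE + mf / 2) cDA KE ℓ₀ ℓ₁ * ‖s - t‖ := fun s t hps hpt hs ht j hj x hx => by
    simpa only [Pi.sub_apply] using psiP5src_sub_bd2_at (Ω := Ω) hL hη R gpar Eterm (norm_nonneg (s - t)) hBR ha₁ ha₁' hb₁ hb₁' hcA hcA'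
      hcDA hmE hKE hℓ₀ hℓ₁ hmf hθ hRsub hRbd (hg0 s hps hs) (hg0 t hpt ht) (hg1 s hps hs) (hg1 t hpt ht) (hgL s t hps hpt hs ht) (hE0 s hps hs)
      (hE0 t hpt ht) (hEL s t hps hpt hs ht) hDA hf hA j hj x hx
  exact fixedPoint_kLevel_per hη.le Ω P Gp (PsiP5src η U₀ A DA f R gpar Eterm) hα₄ hBG hM0 hK0
    (fun f m hm hf => hG f m hm hf) hGsub hGper hΨ0 hΨ1 h103 h106

/-- **WHAT THE PERIODIC SOURCED FIXED POINT CARRIES** — `B8Prop5ContractionKLevelSrc.propFive_fixedPoint_kLevel_src_spec` with `hg0`, `hg1`, `hE0` at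
periodic `λ` only and the given `s` periodic: the Neumann identity WITH SOURCE `Z′ + V_{λ′}(RZ′) = W − f`, `|Z′|₍₋₂₎ ≤ 2·mWc(mE + m_f∕2)`, `‖s‖ ≤ B_G·M`
((1.108)'s source), `λ_s = 0` off `Ω₀`. [cite: Balaban1985RegularSpaces, (1.95)–(1.96) p.92, (1.108) p.94, Thm 8 (1.146) p.101; Balaban1985BackgroundPropagators, (3.24) p.394] -/
theorem propFive_fixedPoint_kLevel_src_spec_per (hL : 1 ≤ L) (hη : 0 < η) (P : ℤ)
    (Gp R gpar Eterm : (Site d → 𝔸) → (Site d → 𝔸))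
    {α₄ BG BR a₁ b₁ cA cDA mE mf : ℝ}
    (hBR : 0 ≤ BR) (ha₁ : 0 ≤ a₁) (ha₁' : a₁ ≤ 1 / 24) (hb₁ : 0 < b₁) (hb₁' : b₁ ≤ 1 / 140)
    (hcA : 0 ≤ cA) (hcA' : cA ≤ 1 / 13) (hcDA : 0 ≤ cDA) (hmE : 0 ≤ mE) (hmf : 0 ≤ mf) (hθ : 10 * a₁ * BR ≤ 1 / 2)
    (hG : ∀ (f : Site d → 𝔸) (m : ℝ), 0 ≤ m → Bd2 L η k Ω f m →
      (∀ x, ‖Gp f x‖ ≤ BG * m) ∧ ∀ j, j ≤ k → ∀ p ∈ Eb j, wt L η j * ‖covDerivFwd η U₀ p.2 (Gp f) p.1‖ ≤ BG * m)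
    (hGsupp : ∀ (f : Site d → 𝔸) (x : Site d), x ∉ Ω 0 → Gp f x = 0)
    (hRsub : ∀ f g : Site d → 𝔸, R (f - g) = R f - R g)
    (hRbd : ∀ (f : Site d → 𝔸) (m : ℝ), 0 ≤ m → Bd2 L η k Ω f m → Bd2 L η k Ω (R f) (BR * m))
    (hg0 : ∀ s : lamSubK η U₀ L k Eb, (∀ (z : Site d) (i : Fin d), lamOf s (z + P • e i) = lamOf s z) → ‖s‖ ≤ α₄ / 4 → ∀ j, j ≤ k → ∀ x ∈ Ω j, ‖gpar (lamOf s) x‖ ≤ a₁)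
    (hg1 : ∀ s : lamSubK η U₀ L k Eb, (∀ (z : Site d) (i : Fin d), lamOf s (z + P • e i) = lamOf s z) → ‖s‖ ≤ α₄ / 4 → ∀ j, j ≤ k → ∀ x ∈ Ω j, ∀ μ : Fin d,
      wt L η j * ‖covDerivFwd η U₀ μ (gpar (lamOf s)) x‖ ≤ b₁ ∧ wt L η j * ‖covDeriv η U₀ μ (gpar (lamOf s)) x‖ ≤ b₁)
    (hE0 : ∀ s : lamSubK η U₀ L k Eb, (∀ (z : Site d) (i : Fin d), lamOf s (z + P • e i) = lamOf s z) → ‖s‖ ≤ α₄ / 4 → Bd2 L η k Ω (Eterm (lamOf s)) mE)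
    (hDA : Bd2 L η k Ω DA cDA) (hf : Bd2 L η k Ω f mf)
    (hA : ∀ j, j ≤ k → ∀ x ∈ Ω j, ∀ μ : Fin d,
      wt L η j * ‖A x μ‖ ≤ cA ∧ wt L η j * ‖conjR (U₀ (x - e μ) μ)⁻¹ (A (x - e μ) μ)‖ ≤ cA)
    {s : lamSubK η U₀ L k Eb} (hp : (∀ (z : Site d) (i : Fin d), lamOf s (z + P • e i) = lamOf s z)) (hs : ‖s‖ ≤ α₄ / 4)
    (hfix : lamOf s = Gp (PsiP5src η U₀ A DA f R gpar Eterm (lamOf s))) :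
    (∀ j, j ≤ k → ∀ x ∈ Ω j,
      Zsol (Wsrc η U₀ A DA (gpar (lamOf s)) (Eterm (lamOf s)) - f) (Vop (gpar (lamOf s))) R x +
        Vop (gpar (lamOf s)) (R (Zsol (Wsrc η U₀ A DA (gpar (lamOf s)) (Eterm (lamOf s)) - f) (Vop (gpar (lamOf s))) R)) x =
      Wsrc η U₀ A DA (gpar (lamOf s)) (Eterm (lamOf s)) x - f x) ∧
    Bd2 L η k Ω (Zsol (Wsrc η U₀ A DA (gpar (lamOf s)) (Eterm (lamOf s)) - f) (Vop (gpar (lamOf s))) R) (2 * mWc d b₁ cA (mE + mf / 2) cDA) ∧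
    ‖s‖ ≤ BG * Mc d BR b₁ cA (mE + mf / 2) cDA ∧
    (∀ x, x ∉ Ω 0 → lamOf s x = 0) := by
  set mW := mWc d b₁ cA (mE + mf / 2) cDA with hmWdef
  have hmE' : 0 ≤ mE + mf / 2 := by positivity
  have hmW : 0 ≤ mW := mWc_nonneg hb₁.le hcA hmE' hcDA
  have hcV : 0 ≤ 10 * a₁ := by positivity
  have ha12 : a₁ ≤ 1 / 12 := by linarith
  have hb70 : b₁ ≤ 1 / 70 := by linarith
  have hcA12 : cA ≤ 1 / 12 := by linarith
  have hVsub : ∀ f g : Site d → 𝔸, ∀ j, j ≤ k → ∀ x ∈ Ω j,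
      Vop (gpar (lamOf s)) f x - Vop (gpar (lamOf s)) g x = Vop (gpar (lamOf s)) (f - g) x :=
    fun f g j hj x hx => Vop_sub f g ((hg0 s hp hs j hj x hx).trans ha12)
  have hVbd : ∀ f : Site d → 𝔸, ∀ j, j ≤ k → ∀ x ∈ Ω j, ‖Vop (gpar (lamOf s)) f x‖ ≤ 10 * a₁ * ‖f x‖ :=
    fun f j hj x hx => norm_Vop_le f (hg0 s hp hs j hj x hx) ha12
  have hW0 : Bd2 L η k Ω (Wsrc η U₀ A DA (gpar (lamOf s)) (Eterm (lamOf s))) (mWc d b₁ cA mE cDA) :=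
    fun j hj x hx => wt_sq_norm_Wsrc_le hL hη hb70 hcA hcA12 ((hg0 s hp hs j hj x hx).trans ha12) (hg1 s hp hs j hj x hx) (hA j hj x hx)
      (hE0 s hp hs j hj x hx) (hDA j hj x hx)
  have hW : Bd2 L η k Ω (Wsrc η U₀ A DA (gpar (lamOf s)) (Eterm (lamOf s)) - f) mW := by
    rw [hmWdef, ← mWc_add_half]; exact hW0.sub hf
  have hZ := bd2_zsol hL hη hVsub hVbd hRsub hRbd hW hcV hBR hmW hθ
  refine ⟨fun j hj x hx => ?_, hZ, ?_, ?_⟩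
  · have h := zsol_eq hL hη hVsub hVbd hRsub hRbd hW hcV hBR hmW hθ hj hx
    rw [h, Pi.sub_apply]
  · -- ‖s‖ ≤ B_G·M from the fixed-point equation and the letter bound
    have hΨ : Bd2 L η k Ω (PsiP5src η U₀ A DA f R gpar Eterm (lamOf s)) (Mc d BR b₁ cA (mE + mf / 2) cDA) :=
      hRbd _ _ (by positivity) hZ.neg
    have hB : 0 ≤ BG * Mc d BR b₁ cA (mE + mf / 2) cDA := by
      obtain ⟨h0, -⟩ := hG _ _ (by unfold Mc; positivity) hΨ
      exact (norm_nonneg _).trans (h0 0)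
    refine (norm_le_iff hη.le s hB).2 ⟨fun x => ?_, fun j hj p hp => ?_⟩
    · rw [hfix]; exact (hG _ _ (by unfold Mc; positivity) hΨ).1 x
    · rw [hfix]; exact (hG _ _ (by unfold Mc; positivity) hΨ).2 j hj p hp
  · intro x hx
    rw [hfix]; exact hGsupp _ x hx

end General

/-! ## §2 Reality of the periodic sourced fixed point (Hermitian source) -/

section CStar

variable {𝔸 : Type*} [CStarAlgebra 𝔸] [Nontrivial 𝔸]
variable {L k : ℕ} {η : ℝ} {Ω : ℕ → Set (Site d)} {Eb : ℕ → Set (Site d × Fin d)} {U₀ : Site d → Fin d → 𝔸ˣ}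
  {A : Site d → Fin d → 𝔸} {DA f : Site d → 𝔸}

/-- **`G′(Ψ_f λ)` is Hermitian for Hermitian data and Hermitian source, AT ONE `λ`** — `B8Prop5ContractionKLevelPer.psiP5_real_at` for `Ψ_f`
(`W − f` Hermitian from `W` and `f` Hermitian on the `Ω_j`). [cite: Balaban1985RegularSpaces, p.93 (after (1.102)), (1.100) p.93, Thm 8 (1.146) p.101] -/
theorem psiP5src_real_at (hL : 1 ≤ L) (hη : 0 < η) (hU₀ : ∀ x κ, U₀ x κ ∈ unitaryUnits 𝔸) (Gp R gpar Eterm : (Site d → 𝔸) → (Site d → 𝔸))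
    {BR a₁ b₁ cA cDA mE mf : ℝ} (hBR : 0 ≤ BR) (ha₁ : 0 ≤ a₁) (ha₁' : a₁ ≤ 1 / 24) (hb₁ : 0 < b₁) (hb₁' : b₁ ≤ 1 / 140)
    (hcA : 0 ≤ cA) (hcA' : cA ≤ 1 / 13) (hcDA : 0 ≤ cDA) (hmE : 0 ≤ mE) (hmf : 0 ≤ mf) (hθ : 10 * a₁ * BR ≤ 1 / 2)
    (hRsub : ∀ f g : Site d → 𝔸, R (f - g) = R f - R g)
    (hRbd : ∀ (f : Site d → 𝔸) (m : ℝ), 0 ≤ m → Bd2 L η k Ω f m → Bd2 L η k Ω (R f) (BR * m))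
    (hRreal : ∀ f : Site d → 𝔸, (∀ j, j ≤ k → ∀ x ∈ Ω j, IsSelfAdjoint (f x)) → ∀ j, j ≤ k → ∀ x ∈ Ω j, IsSelfAdjoint (R f x))
    (hGreal : ∀ f : Site d → 𝔸, (∀ j, j ≤ k → ∀ x ∈ Ω j, IsSelfAdjoint (f x)) → ∀ x, IsSelfAdjoint (Gp f x))
    {lam : Site d → 𝔸} (hg0 : ∀ j, j ≤ k → ∀ x ∈ Ω j, ‖gpar lam x‖ ≤ a₁)
    (hg1 : ∀ j, j ≤ k → ∀ x ∈ Ω j, ∀ μ : Fin d,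
      wt L η j * ‖covDerivFwd η U₀ μ (gpar lam) x‖ ≤ b₁ ∧ wt L η j * ‖covDeriv η U₀ μ (gpar lam) x‖ ≤ b₁)
    (hE0 : Bd2 L η k Ω (Eterm lam) mE) (hDA : Bd2 L η k Ω DA cDA) (hf : Bd2 L η k Ω f mf)
    (hA : ∀ j, j ≤ k → ∀ x ∈ Ω j, ∀ μ : Fin d,
      wt L η j * ‖A x μ‖ ≤ cA ∧ wt L η j * ‖conjR (U₀ (x - e μ) μ)⁻¹ (A (x - e μ) μ)‖ ≤ cA)
    (hAsa : ∀ x μ, IsSelfAdjoint (A x μ)) (hDAsa : ∀ j, j ≤ k → ∀ x ∈ Ω j, IsSelfAdjoint (DA x))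
    (hfsa : ∀ j, j ≤ k → ∀ x ∈ Ω j, IsSelfAdjoint (f x))
    (hasa : ∀ y, IsSelfAdjoint (gpar lam y)) (hEsa : ∀ j, j ≤ k → ∀ x ∈ Ω j, IsSelfAdjoint (Eterm lam x)) :
    ∀ x, IsSelfAdjoint (Gp (PsiP5src η U₀ A DA f R gpar Eterm lam) x) := by
  have hmE' : 0 ≤ mE + mf / 2 := by positivity
  have hmW : 0 ≤ mWc d b₁ cA (mE + mf / 2) cDA := mWc_nonneg hb₁.le hcA hmE' hcDA
  have hcV : 0 ≤ 10 * a₁ := by positivity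
  have ha12 : a₁ ≤ 1 / 12 := by linarith
  have hb70 : b₁ ≤ 1 / 70 := by linarith
  have hcA12 : cA ≤ 1 / 12 := by linarith
  have hVsub : ∀ f g : Site d → 𝔸, ∀ j, j ≤ k → ∀ x ∈ Ω j,
      Vop (gpar lam) f x - Vop (gpar lam) g x = Vop (gpar lam) (f - g) x :=
    fun f g j hj x hx => Vop_sub f g ((hg0 j hj x hx).trans ha12)
  have hVbd : ∀ f : Site d → 𝔸, ∀ j, j ≤ k → ∀ x ∈ Ω j, ‖Vop (gpar lam) f x‖ ≤ 10 * a₁ * ‖f x‖ :=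
    fun f j hj x hx => norm_Vop_le f (hg0 j hj x hx) ha12
  have hW0 : Bd2 L η k Ω (Wsrc η U₀ A DA (gpar lam) (Eterm lam)) (mWc d b₁ cA mE cDA) :=
    fun j hj x hx => wt_sq_norm_Wsrc_le hL hη hb70 hcA hcA12 ((hg0 j hj x hx).trans ha12) (hg1 j hj x hx) (hA j hj x hx)
      (hE0 j hj x hx) (hDA j hj x hx)
  have hW : Bd2 L η k Ω (Wsrc η U₀ A DA (gpar lam) (Eterm lam) - f) (mWc d b₁ cA (mE + mf / 2) cDA) := by
    rw [← mWc_add_half]; exact hW0.sub hf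
  have hWsa : ∀ j, j ≤ k → ∀ x ∈ Ω j, IsSelfAdjoint ((Wsrc η U₀ A DA (gpar lam) (Eterm lam) - f) x) := by
    intro j hj x hx
    rw [Pi.sub_apply]
    exact (isSelfAdjoint_Wsrc hL hη hU₀ hb₁' hcA' hasa (hEsa j hj x hx) (hDAsa j hj x hx) hAsa
      ((hg0 j hj x hx).trans ha₁') (hg1 j hj x hx) (hA j hj x hx)).sub (hfsa j hj x hx)
  have hVsa : ∀ f : Site d → 𝔸, ∀ j, j ≤ k → ∀ x ∈ Ω j, IsSelfAdjoint (f x) → IsSelfAdjoint (Vop (gpar lam) f x) :=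
    fun f j hj x hx hf => isSelfAdjoint_Vop (hasa x) ((hg0 j hj x hx).trans ha12) hf
  have hZsa : ∀ j, j ≤ k → ∀ x ∈ Ω j,
      IsSelfAdjoint (Zsol (Wsrc η U₀ A DA (gpar lam) (Eterm lam) - f) (Vop (gpar lam)) R x) :=
    fun j hj x hx => isSelfAdjoint_zsol hL hη hVsub hVbd hRsub hRbd hW hcV hBR hmW hθ hWsa hVsa hRreal hj hx
  refine hGreal _ (hRreal _ fun j hj x hx => ?_)
  exact (hZsa j hj x hx).neg

/-- ★ **THE PERIODIC SOURCED FIXED POINT IS A REAL CONFIGURATION** — `B8Prop5ContractionKLevelPer.propFive_fixedPoint_kLevel_selfAdjoint_per` for `Ψ_f`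
with a HERMITIAN source `f` on the `Ω_j` (print: `f ∈ R(U₀)`, a space of 𝔤-valued functions): the Sect.-E data and their reality at periodic `λ` only
(`B8LambdaSpaceKLevelOn.fixedPoint_kLevel_per_selfAdjoint` + `psiP5src_real_at`). [cite: Balaban1985RegularSpaces, p.93 (after (1.102)), (1.100) p.93, (1.107) p.94, Thm 8 (1.146) p.101] -/
theorem propFive_fixedPoint_kLevel_src_selfAdjoint_per (hL : 1 ≤ L) (hη : 0 < η) (hU₀ : ∀ x κ, U₀ x κ ∈ unitaryUnits 𝔸) (P : ℤ)
    (Gp R gpar Eterm : (Site d → 𝔸) → (Site d → 𝔸))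
    {α₄ BG BR a₁ b₁ cA cDA mE KE ℓ₀ ℓ₁ mf : ℝ}
    (hα₄ : 0 ≤ α₄) (hBG : 0 ≤ BG) (hBR : 0 ≤ BR) (ha₁ : 0 ≤ a₁) (ha₁' : a₁ ≤ 1 / 24) (hb₁ : 0 < b₁) (hb₁' : b₁ ≤ 1 / 140)
    (hcA : 0 ≤ cA) (hcA' : cA ≤ 1 / 13) (hcDA : 0 ≤ cDA) (hmE : 0 ≤ mE) (hKE : 0 ≤ KE) (hℓ₀ : 0 ≤ ℓ₀) (hℓ₁ : 0 ≤ ℓ₁) (hmf : 0 ≤ mf)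
    (hθ : 10 * a₁ * BR ≤ 1 / 2)
    (hG : ∀ (f : Site d → 𝔸) (m : ℝ), 0 ≤ m → Bd2 L η k Ω f m →
      (∀ x, ‖Gp f x‖ ≤ BG * m) ∧ ∀ j, j ≤ k → ∀ p ∈ Eb j, wt L η j * ‖covDerivFwd η U₀ p.2 (Gp f) p.1‖ ≤ BG * m)
    (hGsub : ∀ f g : Site d → 𝔸, Gp (f - g) = Gp f - Gp g)
    (hGper : ∀ (f : Site d → 𝔸) (z : Site d) (i : Fin d), Gp f (z + P • e i) = Gp f z)
    (hRsub : ∀ f g : Site d → 𝔸, R (f - g) = R f - R g)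
    (hRbd : ∀ (f : Site d → 𝔸) (m : ℝ), 0 ≤ m → Bd2 L η k Ω f m → Bd2 L η k Ω (R f) (BR * m))
    (hg0 : ∀ s : lamSubK η U₀ L k Eb, (∀ (z : Site d) (i : Fin d), lamOf s (z + P • e i) = lamOf s z) → ‖s‖ ≤ α₄ / 4 →
      ∀ j, j ≤ k → ∀ x ∈ Ω j, ‖gpar (lamOf s) x‖ ≤ a₁)
    (hg1 : ∀ s : lamSubK η U₀ L k Eb, (∀ (z : Site d) (i : Fin d), lamOf s (z + P • e i) = lamOf s z) → ‖s‖ ≤ α₄ / 4 →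
      ∀ j, j ≤ k → ∀ x ∈ Ω j, ∀ μ : Fin d,
      wt L η j * ‖covDerivFwd η U₀ μ (gpar (lamOf s)) x‖ ≤ b₁ ∧ wt L η j * ‖covDeriv η U₀ μ (gpar (lamOf s)) x‖ ≤ b₁)
    (hgL : ∀ s t : lamSubK η U₀ L k Eb, (∀ (z : Site d) (i : Fin d), lamOf s (z + P • e i) = lamOf s z) → (∀ (z : Site d) (i : Fin d), lamOf t (z + P • e i) = lamOf t z) →
      ‖s‖ ≤ α₄ / 4 → ‖t‖ ≤ α₄ / 4 → ∀ j, j ≤ k → ∀ x ∈ Ω j,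
      ‖gpar (lamOf s) x - gpar (lamOf t) x‖ ≤ ℓ₀ * ‖s - t‖ ∧ ∀ μ : Fin d,
        wt L η j * ‖covDerivFwd η U₀ μ (gpar (lamOf s) - gpar (lamOf t)) x‖ ≤ ℓ₁ * ‖s - t‖ ∧
        wt L η j * ‖covDeriv η U₀ μ (gpar (lamOf s) - gpar (lamOf t)) x‖ ≤ ℓ₁ * ‖s - t‖)
    (hE0 : ∀ s : lamSubK η U₀ L k Eb, (∀ (z : Site d) (i : Fin d), lamOf s (z + P • e i) = lamOf s z) → ‖s‖ ≤ α₄ / 4 →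
      Bd2 L η k Ω (Eterm (lamOf s)) mE)
    (hEL : ∀ s t : lamSubK η U₀ L k Eb, (∀ (z : Site d) (i : Fin d), lamOf s (z + P • e i) = lamOf s z) → (∀ (z : Site d) (i : Fin d), lamOf t (z + P • e i) = lamOf t z) →
      ‖s‖ ≤ α₄ / 4 → ‖t‖ ≤ α₄ / 4 → Bd2 L η k Ω (Eterm (lamOf s) - Eterm (lamOf t)) (KE * ‖s - t‖))
    (hDA : Bd2 L η k Ω DA cDA) (hf : Bd2 L η k Ω f mf)
    (hA : ∀ j, j ≤ k → ∀ x ∈ Ω j, ∀ μ : Fin d,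
      wt L η j * ‖A x μ‖ ≤ cA ∧ wt L η j * ‖conjR (U₀ (x - e μ) μ)⁻¹ (A (x - e μ) μ)‖ ≤ cA)
    (h103 : BG * Mc d BR b₁ cA (mE + mf / 2) cDA ≤ α₄ / 4) (h106 : BG * Kc d BR b₁ cA (mE + mf / 2) cDA KE ℓ₀ ℓ₁ ≤ 1 / 2)
    -- reality of the data and of the source
    (hAsa : ∀ x μ, IsSelfAdjoint (A x μ)) (hDAsa : ∀ j, j ≤ k → ∀ x ∈ Ω j, IsSelfAdjoint (DA x))
    (hfsa : ∀ j, j ≤ k → ∀ x ∈ Ω j, IsSelfAdjoint (f x))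
    (hgsa : ∀ s : lamSubK η U₀ L k Eb, (∀ (z : Site d) (i : Fin d), lamOf s (z + P • e i) = lamOf s z) → ‖s‖ ≤ α₄ / 4 →
      (∀ x, IsSelfAdjoint (lamOf s x)) → ∀ x, IsSelfAdjoint (gpar (lamOf s) x))
    (hEsa : ∀ s : lamSubK η U₀ L k Eb, (∀ (z : Site d) (i : Fin d), lamOf s (z + P • e i) = lamOf s z) → ‖s‖ ≤ α₄ / 4 →
      (∀ x, IsSelfAdjoint (lamOf s x)) → ∀ j, j ≤ k → ∀ x ∈ Ω j, IsSelfAdjoint (Eterm (lamOf s) x))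
    (hRreal : ∀ f : Site d → 𝔸, (∀ j, j ≤ k → ∀ x ∈ Ω j, IsSelfAdjoint (f x)) → ∀ j, j ≤ k → ∀ x ∈ Ω j, IsSelfAdjoint (R f x))
    (hGreal : ∀ f : Site d → 𝔸, (∀ j, j ≤ k → ∀ x ∈ Ω j, IsSelfAdjoint (f x)) → ∀ x, IsSelfAdjoint (Gp f x))
    {s : lamSubK η U₀ L k Eb} (hp : (∀ (z : Site d) (i : Fin d), lamOf s (z + P • e i) = lamOf s z)) (hs : ‖s‖ ≤ α₄ / 4)
    (hfix : lamOf s = Gp (PsiP5src η U₀ A DA f R gpar Eterm (lamOf s))) :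
    ∀ x, IsSelfAdjoint (lamOf s x) := by
  have hmE' : 0 ≤ mE + mf / 2 := by positivity
  have hmW : 0 ≤ mWc d b₁ cA (mE + mf / 2) cDA := mWc_nonneg hb₁.le hcA hmE' hcDA
  have hKW : 0 ≤ KWc d b₁ cA (mE + mf / 2) cDA KE ℓ₀ ℓ₁ := KWc_nonneg hb₁.le hcA hmE' hcDA hKE hℓ₀ hℓ₁
  have hM0 : 0 ≤ Mc d BR b₁ cA (mE + mf / 2) cDA := by unfold Mc; positivity
  have hK0 : 0 ≤ Kc d BR b₁ cA (mE + mf / 2) cDA KE ℓ₀ ℓ₁ := by unfold Kc; positivity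
  have hΨ0 : ∀ s : lamSubK η U₀ L k Eb, (∀ (z : Site d) (i : Fin d), lamOf s (z + P • e i) = lamOf s z) → ‖s‖ ≤ α₄ / 4 →
      ∀ j, j ≤ k → ∀ x ∈ Ω j, wt L η j ^ 2 * ‖PsiP5src η U₀ A DA f R gpar Eterm (lamOf s) x‖ ≤ Mc d BR b₁ cA (mE + mf / 2) cDA :=
    fun s hp hs => psiP5src_bd2_at (Ω := Ω) hL hη R gpar Eterm hBR ha₁ ha₁' hb₁ hb₁' hcA hcA' hcDA hmE hmf hθ hRsub hRbd (hg0 s hp hs)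
      (hg1 s hp hs) (hE0 s hp hs) hDA hf hA
  have hΨ1 : ∀ s t : lamSubK η U₀ L k Eb, (∀ (z : Site d) (i : Fin d), lamOf s (z + P • e i) = lamOf s z) →
      (∀ (z : Site d) (i : Fin d), lamOf t (z + P • e i) = lamOf t z) → ‖s‖ ≤ α₄ / 4 → ‖t‖ ≤ α₄ / 4 → ∀ j, j ≤ k → ∀ x ∈ Ω j,
      wt L η j ^ 2 * ‖PsiP5src η U₀ A DA f R gpar Eterm (lamOf s) x - PsiP5src η U₀ A DA f R gpar Eterm (lamOf t) x‖ ≤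
        Kc d BR b₁ cA (mE + mf / 2) cDA KE ℓ₀ ℓ₁ * ‖s - t‖ := fun s t hps hpt hs ht j hj x hx => by
    simpa only [Pi.sub_apply] using psiP5src_sub_bd2_at (Ω := Ω) hL hη R gpar Eterm (norm_nonneg (s - t)) hBR ha₁ ha₁' hb₁ hb₁' hcA hcA'
      hcDA hmE hKE hℓ₀ hℓ₁ hmf hθ hRsub hRbd (hg0 s hps hs) (hg0 t hpt ht) (hg1 s hps hs) (hg1 t hpt ht) (hgL s t hps hpt hs ht) (hE0 s hps hs)
      (hE0 t hpt ht) (hEL s t hps hpt hs ht) hDA hf hA j hj x hx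
  exact fixedPoint_kLevel_per_selfAdjoint hη.le Ω P Gp (PsiP5src η U₀ A DA f R gpar Eterm) hα₄ hBG hM0 hK0
    (fun f m hm hf => hG f m hm hf) hGsub hGper hΨ0 hΨ1 h103 h106
    (fun t hpt ht hsa => psiP5src_real_at (Ω := Ω) hL hη hU₀ Gp R gpar Eterm hBR ha₁ ha₁' hb₁ hb₁' hcA hcA' hcDA hmE hmf hθ hRsub hRbd hRreal
      hGreal (hg0 t hpt ht) (hg1 t hpt ht) (hE0 t hpt ht) hDA hf hA hAsa hDAsa hfsa (hgsa t hpt ht hsa) (hEsa t hpt ht hsa))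
    hp hs hfix

end CStar

#print axioms psiP5src_bd2_at
#print axioms psiP5src_sub_bd2_at
#print axioms propFive_fixedPoint_kLevel_src_per
#print axioms propFive_fixedPoint_kLevel_src_spec_per
#print axioms propFive_fixedPoint_kLevel_src_selfAdjoint_per

end Literature.MathematicalPhysics.QuantumFieldTheory.Balaban1983to89.B8Prop5ContractionKLevelSrcPer

end
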